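import Literature.MathematicalPhysics.QuantumFieldTheory.Balaban1983to89.B15Prop1CarrierOnFromLetters
import Literature.MathematicalPhysics.QuantumFieldTheory.Balaban1983to89.B15Prop1MinimumBall

/-!
# `Balaban1983to89.B15Prop1LocalLettersModel` — [Balaban1989LargeFieldI] Prop. 1 p. 194 / [Balaban1989LargeFieldII] pp. 358–359: THE N12∕s1
# CHAIN RE-THREADED WITH LOCAL LETTERS, LAYERS 0–1 — Proposition 1 at the carrier of record `lfVarOn ch I` from the p. 359 model
# (`prop1Printed_lfVarOn_of_model_local`) and from the letters (`prop1Printed_lfVarOn_of_letters_local`), every per-`V_k` datum letter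
# asked ONLY at REGULAR boundary data (`Rg i Vk`) and the first-variation ∕ criticality letters ONLY on the ball `‖B′‖ ≤ r`

statement-level skeleton of published theorems with citation tags; proofs where landed; nothing here is a claim about
the Yang–Mills mass gap

Cell pub-ymgap, HUMAN RULING D-0062 (Track A full width), seat `pub-ymgap-dag-n12-c` (R134 acceleration seat (a), strategy s1 of DAG node
N12 = [B15]; generation g4, sixth product; SELF-AUDIT TS-LETTERS-GLOBAL, pub-ymgap INBOX 2026-08-27 ≈04:09Z).

WHY (the located typing-strength point).  In the landed chain `B15Prop1CarrierOnFromModel.prop1Printed_lfVarOn_of_model_sol` (p465973) →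
… → `B15Prop1CriticalAtBoxG0.exists_domain_prop1Printed_lfVarOn_std_su2_box_of_fderiv` (p494166) the per-`V_k` DATA letters (`hpos`, `hH`,
`hHst`, `hdV0`, `hdV`, later `h17`∕`hlead`, `hW`) quantify over ALL boundary data `V_k`, and the first-variation letter (m5) `hA` over ALL chart
points `X` — whereas print ([IV] Prop. 1: *«For a configuration V_k↾_{Z∩Λᶜ} satisfying the regularity condition»*; [LF-II] p. 359: *«where V′
satisfies mild regularity conditions … we can write V′ = exp iB′. We expand the function with respect to B′»*) gives the objects and the
expansion only for ε-REGULAR `V_k` and SMALL `B′`; the proofs use every per-`V_k` letter only at the given regular `V_k` and `hA` only on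
the gauge segment inside the ball.  THIS FILE starts the same chain with LOCAL letters: an abstract regularity predicate `Rg i Vk` with the
bridge `hRg : ∀ i ε Vk, 0 < ε → ε ≤ eR i → (lfVarOn ch I).Regular i ε Vk → Rg i Vk`, every per-`V_k` letter premised on `Rg i Vk`, `hA`∕`hc3`
on `‖X‖ ≤ r i`; the threshold becomes `e0 i = min (min (min (eA i) (eD i)) (eR i)) (r i ∕ (2(M i)⁵hst·cJ∕γ + 1))`.  The minimum ∕ uniqueness
steps use the ball versions `B15Prop1MinimumBall.le_of_critical_ball` ∕ `critical_unique_of_chart_ball`.  Landed theorems are untouched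
(they are the `Rg := ⊤`, global-`hA` special case).

WHAT THIS FILE PROVES (no `sorry`, no definition, no `… : Prop` fact; axioms standard): ★ `prop1Printed_lfVarOn_of_model_local`,
★ `prop1Printed_lfVarOn_of_letters_local` — the statements of the originals with the letters localized as above (proofs verbatim otherwise).

HONEST SCOPE.  Count-neutral; NOT a discharge of N12; nothing of Proposition 1 asserted beyond the displayed letters; nothing continuum ∕ OS ∕
mass-gap ∕ Clay.
-/

noncomputable section

open Set
open scoped RealInnerProductSpace

namespace Literature.MathematicalPhysics.QuantumFieldTheory.Balaban1983to89.B15Prop1LocalLettersModel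

open Literature.MathematicalPhysics.QuantumFieldTheory.Balaban1983to89
open B15DeterminingSets GaugeField B16Sect1Backgrounds B15Prop1Carrier B8Eq17ClassAkV1
open B15Prop1GaugeFixing B15Prop1CarrierOnFromModel B15Prop1CarrierOnFromLetters

variable {P : Params}

/-- Threshold bookkeeping: `ε ≤ r/(K + 1)`, `K ≥ 0`, `r > 0` ⇒ `K·ε ≤ r` (private plumbing, as in `B15Prop1CarrierOnFromModel`). [folklore] -/
private theorem threshold_arith {K r ε : ℝ} (hK : 0 ≤ K) (hr : 0 < r) (hε : ε ≤ r / (K + 1)) : K * ε ≤ r := by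
  have hK1 : 0 < K + 1 := by linarith
  have hfrac : K / (K + 1) ≤ 1 := by rw [div_le_one hK1]; linarith
  calc K * ε ≤ K * (r / (K + 1)) := mul_le_mul_of_nonneg_left hε hK
    _ = r * (K / (K + 1)) := by ring
    _ ≤ r * 1 := mul_le_mul_of_nonneg_left hfrac hr.le
    _ = r := mul_one r

/-- (1.78) bookkeeping: `a·(K·ε) + b·M²·ε < (2·a·hst·cJ/γ + b + 1)·M⁵·ε` (private plumbing, as in `B15Prop1CarrierOnFromModel`). [folklore] -/
private theorem dev_arith {a b hst cJ γ M ε : ℝ} (hb : 0 ≤ b) (hM : 1 ≤ M) (hε : 0 < ε) :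
    a * (2 * M ^ 5 * hst * cJ / γ * ε) + b * M ^ 2 * ε < (2 * a * hst * cJ / γ + b + 1) * M ^ 5 * ε := by
  have hM2 : M ^ 2 ≤ M ^ 5 := pow_le_pow_right₀ hM (by norm_num)
  have hM5 : 0 < M ^ 5 := by positivity
  have h1 : a * (2 * M ^ 5 * hst * cJ / γ * ε) = 2 * a * hst * cJ / γ * M ^ 5 * ε := by ring
  have h2 : b * M ^ 2 * ε ≤ b * M ^ 5 * ε :=
    mul_le_mul_of_nonneg_right (mul_le_mul_of_nonneg_left hM2 hb) hε.le
  have h3 : 0 < M ^ 5 * ε := mul_pos hM5 hε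
  have h4 : (2 * a * hst * cJ / γ + b + 1) * M ^ 5 * ε =
      2 * a * hst * cJ / γ * M ^ 5 * ε + b * M ^ 5 * ε + M ^ 5 * ε := by ring
  rw [h1, h4]
  linarith

/-! ## §1 Layer 0: from the p. 359 model, local letters -/

section Model

variable {G : Type} [GaugeGroup G] {𝔤 : Type*} [AddCommGroup 𝔤] [Module ℝ 𝔤]

/-- **PROPOSITION 1 [IV] AT THE CARRIER OF RECORD FROM THE p. 359 MODEL — LOCAL LETTERS.**  `B15Prop1CarrierOnFromModel.
prop1Printed_lfVarOn_of_model_sol` with: a regularity predicate `Rg i Vk` bridged to the carrier's `Regular` below the scale `eR i` (`hRg`);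
the per-`V_k` data letters `hpos`, `hH`, `hHst`, `hdV0`, `hdV`, the first-variation letter `hA` and the criticality letter `hc3` asked ONLY for
`Rg i Vk`, and `hA` only on the ball `‖X‖ ≤ r i` (print: regular `V_k`, small `B′`).  Same proof; minimum and uniqueness by the ball lemmas of
`B15Prop1MinimumBall`; threshold `e0 i = min (min (min (eA i) (eD i)) (eR i)) (r i/(2(M i)⁵hst·cJ/γ + 1))`.
[cite: Balaban1989LargeFieldI, Prop. 1 (1.77)–(1.78) p.194; Balaban1989LargeFieldII, pp.358–359 (proof of Proposition 1 [IV]), (1.9), (1.12)–(1.13);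
Balaban1985Variational, Prop. 4 p.293] -/
theorem prop1Printed_lfVarOn_of_model_local (ch : ExpChart G 𝔤) {ι : Type} (I : ι → InstOn P G)
    (Rg : ∀ i, GaugeField P (I i).k G → Prop)
    {E F : ι → Type*}
    [∀ i, NormedAddCommGroup (E i)] [∀ i, InnerProductSpace ℝ (E i)] [∀ i, FiniteDimensional ℝ (E i)]
    [∀ i, NormedAddCommGroup (F i)] [∀ i, InnerProductSpace ℝ (F i)]
    (P₀ : ∀ i, E i →ₗ[ℝ] E i) (hP2 : ∀ i x, P₀ i (P₀ i x) = P₀ i x) (hPsa : ∀ i (x y : E i), ⟪P₀ i x, y⟫ = ⟪x, P₀ i y⟫)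
    (H : ∀ i, GaugeField P (I i).k G → (E i →ₗ[ℝ] F i)) (Hst : ∀ i, GaugeField P (I i).k G → (F i →ₗ[ℝ] E i))
    (hadj : ∀ i Vk (x : E i) (y : F i), ⟪H i Vk x, y⟫ = ⟪x, Hst i Vk y⟫)
    (Δ₁ : ∀ i, GaugeField P (I i).k G → (F i →ₗ[ℝ] F i)) (dV : ∀ i, GaugeField P (I i).k G → F i → F i)
    (J : ∀ i, GaugeField P (I i).k G → F i)
    (φ : ∀ i, GaugeField P (I i).k G → E i → GaugeField P (I i).k G)
    {γ h₁ hst cJ a b : ℝ} (hγ : 0 < γ) (hh₁ : 0 ≤ h₁) (hhst : 0 ≤ hst) (hcJ : 0 ≤ cJ) (ha : 0 ≤ a) (hb : 0 ≤ b)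
    {ℓ ρ r eA eD eR : ι → ℝ} (hℓ : ∀ i, 0 ≤ ℓ i) (hr : ∀ i, 0 < r i) (heA : ∀ i, 0 < eA i) (heD : ∀ i, 0 < eD i)
    (heR : ∀ i, 0 < eR i) (hRg : ∀ i ε Vk, 0 < ε → ε ≤ eR i → (lfVarOn ch I).Regular i ε Vk → Rg i Vk)
    (hM : ∀ i, 1 ≤ (I i).M)
    (hpos : ∀ i Vk, Rg i Vk → ∀ x, P₀ i x = x → γ / (I i).M ^ 5 * ‖x‖ ^ 2 ≤ ⟪H i Vk x, Δ₁ i Vk (H i Vk x)⟫)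
    (hH : ∀ i Vk, Rg i Vk → ∀ x, ‖H i Vk x‖ ≤ h₁ * ‖x‖) (hHst : ∀ i Vk, Rg i Vk → ∀ z, ‖Hst i Vk z‖ ≤ hst * ‖z‖)
    (hdV0 : ∀ i Vk, Rg i Vk → dV i Vk 0 = 0)
    (hdV : ∀ i Vk, Rg i Vk → ∀ u v : F i, ‖u‖ ≤ ρ i → ‖v‖ ≤ ρ i → ‖dV i Vk u - dV i Vk v‖ ≤ ℓ i * ‖u - v‖)
    (hρ : ∀ i, h₁ * r i ≤ ρ i) (hsmall : ∀ i, (I i).M ^ 5 / γ * hst * ℓ i * h₁ ≤ 1 / 2)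
    (hA : ∀ i Vk, Rg i Vk → ∀ X δ : E i, ‖X‖ ≤ r i → HasDerivAt (fun s : ℝ => (I i).f (φ i Vk (X + s • δ)))
      (⟪δ, Hst i Vk (J i Vk)⟫ + ⟪δ, Hst i Vk (Δ₁ i Vk (H i Vk X))⟫ + ⟪δ, Hst i Vk (dV i Vk (H i Vk X))⟫) 0)
    (hJ : ∀ i ε Vk, 0 < ε → (lfVarOn ch I).Regular i ε Vk → ‖J i Vk‖ ≤ cJ * ε)
    (hc1 : ∀ i ε Vk (B : E i), 0 < ε → ε ≤ eD i → (lfVarOn ch I).Regular i ε Vk → P₀ i B = B →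
      ‖B‖ ≤ 2 * (I i).M ^ 5 * hst * cJ / γ * ε →
      orbit (pts (I i).k (I i).Λ) (φ i Vk B) ⊆ extSet (bondsOf (pts (I i).k (I i).Λ)) Vk ∩ (I i).dom)
    (hc2 : ∀ i ε Vk (V : GaugeField P (I i).k G), 0 < ε → ε ≤ eD i → (lfVarOn ch I).Regular i ε Vk →
      V ∈ extSet (bondsOf (pts (I i).k (I i).Λ)) Vk ∩ (I i).dom →
        ∃ B : E i, P₀ i B = B ∧ ‖B‖ ≤ r i ∧ V ∈ orbit (pts (I i).k (I i).Λ) (φ i Vk B))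
    (hc3 : ∀ i Vk, Rg i Vk → ∀ B : E i, P₀ i B = B → ‖B‖ ≤ r i →
      (IsCriticalPt ch (bondsOf (pts (I i).k (I i).Λ)) (I i).f (φ i Vk B) ↔
        ∀ δB : E i, P₀ i δB = δB →
          ⟪δB, Hst i Vk (J i Vk)⟫ + ⟪δB, Hst i Vk (Δ₁ i Vk (H i Vk B))⟫ + ⟪δB, Hst i Vk (dV i Vk (H i Vk B))⟫ = 0))
    (hc3' : ∀ i (u : GaugeTransf P (I i).k G) (V : GaugeField P (I i).k G), IsGaugeOn (pts (I i).k (I i).Λ) u →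
      IsCriticalPt ch (bondsOf (pts (I i).k (I i).Λ)) (I i).f V →
        IsCriticalPt ch (bondsOf (pts (I i).k (I i).Λ)) (I i).f (gaugeAct u V))
    (hc3'' : ∀ i (u : GaugeTransf P (I i).k G) (V : GaugeField P (I i).k G), IsGaugeOn (pts (I i).k (I i).Λ) u →
      (I i).f (gaugeAct u V) = (I i).f V)
    (hc4 : ∀ i ε Vk (B : E i), 0 < ε → (lfVarOn ch I).Regular i ε Vk → P₀ i B = B → ‖B‖ ≤ r i →
      ∀ p ∈ plaqsOf (pts (I i).k (I i).Λ), dist1 (plaqHol (φ i Vk B) p) ≤ a * ‖B‖ + b * (I i).M ^ 2 * ε)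
    (hAn : ∀ i ε Vk, 0 < ε → ε ≤ eA i → (lfVarOn ch I).Regular i ε Vk → (I i).An ε Vk) :
    B15.Prop1Printed (lfVarOn ch I) := by
  rw [prop1Printed_lfVarOn_iff]
  refine ⟨2 * a * hst * cJ / γ + b + 1, by positivity, fun i => ?_⟩
  -- the per-instance letters: positivity constant `c = γ/M⁵` of (1.9) and the radius factor `K = 2M⁵hst·cJ/γ`
  have hM0 : 0 < (I i).M := lt_of_lt_of_le one_pos (hM i)
  have hc : 0 < γ / (I i).M ^ 5 := div_pos hγ (pow_pos hM0 5)
  have hcinv : (γ / (I i).M ^ 5)⁻¹ = (I i).M ^ 5 / γ := inv_div _ _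
  have hK : 0 ≤ 2 * (I i).M ^ 5 * hst * cJ / γ := by positivity
  refine ⟨min (min (min (eA i) (eD i)) (eR i)) (r i / (2 * (I i).M ^ 5 * hst * cJ / γ + 1)),
    lt_min (lt_min (lt_min (heA i) (heD i)) (heR i)) (div_pos (hr i) (by linarith)), fun ε hε hεle Vk hreg => ?_⟩
  have hεA : ε ≤ eA i := hεle.trans ((min_le_left _ _).trans ((min_le_left _ _).trans (min_le_left _ _)))
  have hεD : ε ≤ eD i := hεle.trans ((min_le_left _ _).trans ((min_le_left _ _).trans (min_le_right _ _)))
  have hεR : ε ≤ eR i := hεle.trans ((min_le_left _ _).trans (min_le_right _ _))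
  have hRVk : Rg i Vk := hRg i ε Vk hε hεR hreg
  have hεK : 2 * (I i).M ^ 5 * hst * cJ / γ * ε ≤ r i :=
    threshold_arith hK (hr i) (hεle.trans (min_le_right _ _))
  -- the model hypotheses at `(i, V_k)`
  have hsmall' : (γ / (I i).M ^ 5)⁻¹ * hst * ℓ i * h₁ ≤ 1 / 2 := by rw [hcinv]; exact hsmall i
  have hJ' : ‖J i Vk‖ ≤ cJ * ε := hJ i ε Vk hε hreg
  have hball : 2 * ((γ / (I i).M ^ 5)⁻¹ * hst * ‖J i Vk‖) ≤ 2 * (I i).M ^ 5 * hst * cJ / γ * ε := by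
    rw [hcinv]
    have := mul_le_mul_of_nonneg_left hJ' (mul_nonneg (div_nonneg (pow_nonneg hM0.le 5) hγ.le) hhst)
    calc 2 * ((I i).M ^ 5 / γ * hst * ‖J i Vk‖) ≤ 2 * ((I i).M ^ 5 / γ * hst * (cJ * ε)) := by linarith
      _ = 2 * (I i).M ^ 5 * hst * cJ / γ * ε := by ring
  have hballr : 2 * ((γ / (I i).M ^ 5)⁻¹ * hst * ‖J i Vk‖) ≤ r i := hball.trans hεK
  have hρ' : h₁ * (2 * ((γ / (I i).M ^ 5)⁻¹ * hst * ‖J i Vk‖)) ≤ ρ i :=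
    (mul_le_mul_of_nonneg_left hballr hh₁).trans (hρ i)
  -- existence + «twice a bound of the right-hand side» (r13, inverse from (1.9))
  obtain ⟨Kinv, -, hJb, B, ⟨hBg, hBn, hBcrit⟩, -⟩ :=
    B16Prop1IVAssembly.prop1IV_model_of_pos (hP2 i) (hPsa i) (H i Vk) (Hst i Vk) (hadj i Vk) (Δ₁ i Vk)
      (dV i Vk) (J i Vk) hc (hpos i Vk hRVk) (hdV0 i Vk hRVk) hh₁ hhst (hℓ i) (hH i Vk hRVk) (hHst i Vk hRVk) (hdV i Vk hRVk)
      hρ' hsmall'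
  have hBK : ‖B‖ ≤ 2 * (I i).M ^ 5 * hst * cJ / γ * ε := hBn.trans (hJb.trans hball)
  have hBr : ‖B‖ ≤ r i := hBK.trans hεK
  -- names for print's objects at this instance
  set S := pts (I i).k (I i).Λ with hS
  set Λb := bondsOf S with hΛb
  have hsub : orbit S (φ i Vk B) ⊆ extSet Λb Vk ∩ (I i).dom := hc1 i ε Vk B hε hεD hreg hBg hBK
  have hcritφ : IsCriticalPt ch Λb (I i).f (φ i Vk B) := (hc3 i Vk hRVk B hBg hBr).2 hBcrit
  refine ⟨orbitOf S (φ i Vk B), ⟨hsub, φ i Vk B, mem_orbitOf_self _ _, hcritφ⟩, ?_, ?_, ?_, hAn i ε Vk hε hεA hreg⟩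
  · -- exactly one critical orbit inside the domain
    rintro O' ⟨hO'sub, V, hV, hVcrit⟩
    obtain ⟨B', hB'g, hB'n, hVorb⟩ := hc2 i ε Vk V hε hεD hreg (hO'sub hV)
    obtain ⟨u, hu, hVu⟩ := hVorb
    have hφB' : φ i Vk B' = gaugeAct (invG u) V := by rw [hVu, gaugeAct_invG_gaugeAct]
    have hcrit' : IsCriticalPt ch Λb (I i).f (φ i Vk B') := by
      rw [hφB']
      exact hc3' i (invG u) V hu.inv hVcrit
    have h112' := (hc3 i Vk hRVk B' hB'g hB'n).1 hcrit'
    have hEq : B' = B :=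
      B15Prop1MinimumBall.critical_unique_of_chart_ball (H i Vk) (Hst i Vk) (hadj i Vk) (Δ₁ i Vk) (dV i Vk) (J i Vk)
        (A := fun X => (I i).f (φ i Vk X)) (hA i Vk hRVk) hc (hpos i Vk hRVk) hh₁ hhst (hℓ i) (hH i Vk hRVk) (hHst i Vk hRVk)
        (hdV i Vk hRVk) (hρ i) hsmall' hBg hBr hBcrit hB'g hB'n h112'
    calc O' = orbitOf S V := (OrbitSp.orbitOf_eq_of_mem hV).symm
      _ = orbitOf S (φ i Vk B') := orbitOf_eq_orbitOf_iff.2 ⟨u, hu, hVu⟩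
      _ = orbitOf S (φ i Vk B) := by rw [hEq]
  · -- an element of the orbit is a minimum of the function over the variables ∩ the domain
    refine ⟨φ i Vk B, mem_orbitOf_self _ _, hsub (mem_orbit_self _ _), fun W hW => ?_⟩
    obtain ⟨B', hB'g, hB'n, u, hu, hWu⟩ := hc2 i ε Vk W hε hεD hreg hW
    rw [hWu, hc3'' i u _ hu]
    exact B15Prop1MinimumBall.le_of_critical_ball (H i Vk) (Hst i Vk) (hadj i Vk) (Δ₁ i Vk) (dV i Vk) (J i Vk)
      (A := fun X => (I i).f (φ i Vk X)) (hA i Vk hRVk) hc (hpos i Vk hRVk) hh₁ hhst (hℓ i) (hH i Vk hRVk) (hHst i Vk hRVk)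
      (hdV i Vk hRVk) (hρ i) hsmall' hBg hBr hBcrit hB'g hB'n
  · -- (1.78) for the orbit
    have hB5 : 0 < (2 * a * hst * cJ / γ + b + 1) * (I i).M ^ 5 * ε := by positivity
    refine orbitDev_orbit_lt hB5 fun p hp => ?_
    calc dist1 (plaqHol (φ i Vk B) p) ≤ a * ‖B‖ + b * (I i).M ^ 2 * ε := hc4 i ε Vk B hε hreg hBg hBr p hp
      _ ≤ a * (2 * (I i).M ^ 5 * hst * cJ / γ * ε) + b * (I i).M ^ 2 * ε := by
          have := mul_le_mul_of_nonneg_left hBK ha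
          linarith
      _ < (2 * a * hst * cJ / γ + b + 1) * (I i).M ^ 5 * ε := dev_arith hb (hM i) hε

end Model

/-! ## §2 Layer 1: from the letters, local -/

section Letters

variable {G : Type} [GaugeGroup G] {𝔥 : Type*} [NormedAddCommGroup 𝔥] [NormedSpace ℝ 𝔥]

/-- **PROPOSITION 1 [IV] AT THE CARRIER OF RECORD FROM THE LETTERS — LOCAL.**  `B15Prop1CarrierOnFromLetters.prop1Printed_lfVarOn_of_letters`
with the per-`V_k` data letters, `hA` and `hc3` localized as in `prop1Printed_lfVarOn_of_model_local` (regular `V_k`, `‖X‖ ≤ r i`); (c1)∕(c2)∕(c4)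
derived from hrep, (ℓ2), (X)∕(ℓ1), (ι1)–(ι3) and the thresholds exactly as there. [cite: Balaban1989LargeFieldI, Prop. 1 (1.77)–(1.78) p.194;
Balaban1989LargeFieldII, pp.358–359, (1.9), (1.12)–(1.13); Balaban1985Variational, Prop. 4 p.293] -/
theorem prop1Printed_lfVarOn_of_letters_local (ch : ExpChart G 𝔥) {ι : Type} (I : ι → InstOn P G)
    (Rg : ∀ i, GaugeField P (I i).k G → Prop)
    [∀ i, DecidableEq (PBond P (I i).k)]
    {E F : ι → Type*}
    [∀ i, NormedAddCommGroup (E i)] [∀ i, InnerProductSpace ℝ (E i)] [∀ i, FiniteDimensional ℝ (E i)]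
    [∀ i, NormedAddCommGroup (F i)] [∀ i, InnerProductSpace ℝ (F i)]
    (P₀ : ∀ i, E i →ₗ[ℝ] E i) (hP2 : ∀ i x, P₀ i (P₀ i x) = P₀ i x) (hPsa : ∀ i (x y : E i), ⟪P₀ i x, y⟫ = ⟪x, P₀ i y⟫)
    (H : ∀ i, GaugeField P (I i).k G → (E i →ₗ[ℝ] F i)) (Hst : ∀ i, GaugeField P (I i).k G → (F i →ₗ[ℝ] E i))
    (hadj : ∀ i Vk (x : E i) (y : F i), ⟪H i Vk x, y⟫ = ⟪x, Hst i Vk y⟫)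
    (Δ₁ : ∀ i, GaugeField P (I i).k G → (F i →ₗ[ℝ] F i)) (dV : ∀ i, GaugeField P (I i).k G → F i → F i)
    (J : ∀ i, GaugeField P (I i).k G → F i)
    (T : ∀ i, Finset (PBond P (I i).k))
    (ext : ∀ i, GaugeField P (I i).k G → GaugeField P (I i).k G)
    (ιA : ∀ i, E i →ₗ[ℝ] VecField P (I i).k 𝔥)
    {γ h₁ hst cJ bx κ Cℓ : ℝ} (hγ : 0 < γ) (hh₁ : 0 ≤ h₁) (hhst : 0 ≤ hst) (hcJ : 0 ≤ cJ) (hbx : 0 ≤ bx) (hκ : 0 ≤ κ)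
    (hCℓ : 0 ≤ Cℓ)
    {ℓ ρ r eA eD a₁ δc N eR : ι → ℝ} (hℓ : ∀ i, 0 ≤ ℓ i) (hr : ∀ i, 0 < r i) (heA : ∀ i, 0 < eA i) (heD : ∀ i, 0 < eD i)
    (heR : ∀ i, 0 < eR i) (hRg : ∀ i ε Vk, 0 < ε → ε ≤ eR i → (lfVarOn ch I).Regular i ε Vk → Rg i Vk)
    (hδc : ∀ i, 0 < δc i) (hM : ∀ i, 1 ≤ (I i).M)
    (hpos : ∀ i Vk, Rg i Vk → ∀ x, P₀ i x = x → γ / (I i).M ^ 5 * ‖x‖ ^ 2 ≤ ⟪H i Vk x, Δ₁ i Vk (H i Vk x)⟫)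
    (hH : ∀ i Vk, Rg i Vk → ∀ x, ‖H i Vk x‖ ≤ h₁ * ‖x‖) (hHst : ∀ i Vk, Rg i Vk → ∀ z, ‖Hst i Vk z‖ ≤ hst * ‖z‖)
    (hdV0 : ∀ i Vk, Rg i Vk → dV i Vk 0 = 0)
    (hdV : ∀ i Vk, Rg i Vk → ∀ u v : F i, ‖u‖ ≤ ρ i → ‖v‖ ≤ ρ i → ‖dV i Vk u - dV i Vk v‖ ≤ ℓ i * ‖u - v‖)
    (hρ : ∀ i, h₁ * r i ≤ ρ i) (hsmall : ∀ i, (I i).M ^ 5 / γ * hst * ℓ i * h₁ ≤ 1 / 2)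
    (hA : ∀ i Vk, Rg i Vk → ∀ X δ : E i, ‖X‖ ≤ r i →
      HasDerivAt (fun s : ℝ => (I i).f (expMul ch (ιA i (X + s • δ)) (ext i Vk)))
      (⟪δ, Hst i Vk (J i Vk)⟫ + ⟪δ, Hst i Vk (Δ₁ i Vk (H i Vk X))⟫ + ⟪δ, Hst i Vk (dV i Vk (H i Vk X))⟫) 0)
    (hJ : ∀ i ε Vk, 0 < ε → (lfVarOn ch I).Regular i ε Vk → ‖J i Vk‖ ≤ cJ * ε)
    (hc3 : ∀ i Vk, Rg i Vk → ∀ B : E i, P₀ i B = B → ‖B‖ ≤ r i →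
      (IsCriticalPt ch (bondsOf (pts (I i).k (I i).Λ)) (I i).f (expMul ch (ιA i B) (ext i Vk)) ↔
        ∀ δB : E i, P₀ i δB = δB →
          ⟪δB, Hst i Vk (J i Vk)⟫ + ⟪δB, Hst i Vk (Δ₁ i Vk (H i Vk B))⟫ + ⟪δB, Hst i Vk (dV i Vk (H i Vk B))⟫ = 0))
    (hc3' : ∀ i (u : GaugeTransf P (I i).k G) (V : GaugeField P (I i).k G), IsGaugeOn (pts (I i).k (I i).Λ) u →
      IsCriticalPt ch (bondsOf (pts (I i).k (I i).Λ)) (I i).f V →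
        IsCriticalPt ch (bondsOf (pts (I i).k (I i).Λ)) (I i).f (gaugeAct u V))
    (hc3'' : ∀ i (u : GaugeTransf P (I i).k G) (V : GaugeField P (I i).k G), IsGaugeOn (pts (I i).k (I i).Λ) u →
      (I i).f (gaugeAct u V) = (I i).f V)
    (hAn : ∀ i ε Vk, 0 < ε → ε ≤ eA i → (lfVarOn ch I).Regular i ε Vk → (I i).An ε Vk)
    -- the domain: print's example
    (hdom : ∀ i, (I i).dom = domReg (I i).Z (I i).k (a₁ i))
    -- the extension letters (ℓ2)
    (hext0 : ∀ i Vk, ext i Vk ∈ extSet (bondsOf (pts (I i).k (I i).Λ)) Vk)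
    (hextZ : ∀ i ε Vk, 0 < ε → ε ≤ eD i → (lfVarOn ch I).Regular i ε Vk →
      ∀ p ∈ plaqsInside (pts (I i).k (I i).Z), dist1 (plaqHol (ext i Vk) p) ≤ bx * (I i).M ^ 2 * ε)
    (hextΛ : ∀ i ε Vk, 0 < ε → (lfVarOn ch I).Regular i ε Vk →
      ∀ p ∈ plaqsOf (pts (I i).k (I i).Λ), dist1 (plaqHol (ext i Vk) p) ≤ bx * (I i).M ^ 2 * ε)
    -- the chart letters (X), (ℓ1)
    (hlog : ∀ i (g : G), dist1 g < δc i → ch.iexp (ch.ilog g) = g)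
    (hlip : ∀ i (g : G), dist1 g < δc i → ‖ch.ilog g‖ ≤ Cℓ * dist1 g)
    (hexp : ∀ X : 𝔥, dist1 (ch.iexp X) ≤ κ * ‖X‖)
    -- the coordinates
    (hι1 : ∀ i (B : E i), P₀ i B = B → IsSupportedOn {b | b ∈ bondsOf (pts (I i).k (I i).Λ) ∧ b ∉ T i} (ιA i B))
    (hι2 : ∀ i (A : VecField P (I i).k 𝔥) (t : ℝ), IsSupportedOn {b | b ∈ bondsOf (pts (I i).k (I i).Λ) ∧ b ∉ T i} A →
      (∀ b, ‖A b‖ ≤ t) → ∃ B : E i, P₀ i B = B ∧ ιA i B = A ∧ ‖B‖ ≤ N i * t)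
    (hι3 : ∀ i (B : E i) (b : PBond P (I i).k), ‖ιA i B b‖ ≤ ‖B‖)
    -- the gauge (G)+(L): the `G₀`-representative and its smallness
    (hrep : ∀ i ε Vk (V : GaugeField P (I i).k G), 0 < ε → ε ≤ eD i → (lfVarOn ch I).Regular i ε Vk →
      V ∈ extSet (bondsOf (pts (I i).k (I i).Λ)) Vk ∩ (I i).dom →
        ∃ u : GaugeTransf P (I i).k G, IsGaugeOn (pts (I i).k (I i).Λ) u ∧
          (∀ b, (b ∈ T i ∨ b ∉ bondsOf (pts (I i).k (I i).Λ)) → gaugeAct u V b = ext i Vk b) ∧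
          ∀ b, b ∈ bondsOf (pts (I i).k (I i).Λ) → b ∉ T i → dist1 (gaugeAct u V b * (ext i Vk b)⁻¹) < δc i)
    -- thresholds
    (hN : ∀ i, N i * (Cℓ * δc i) ≤ r i)
    (he1 : ∀ i ε, 0 < ε → ε ≤ eD i → (4 * κ * (2 * (I i).M ^ 5 * hst * cJ / γ) + bx * (I i).M ^ 2) * ε < a₁ i) :
    B15.Prop1Printed (lfVarOn ch I) := by
  refine prop1Printed_lfVarOn_of_model_local ch I Rg P₀ hP2 hPsa H Hst hadj Δ₁ dV J
    (fun i Vk B => expMul ch (ιA i B) (ext i Vk)) hγ hh₁ hhst hcJ (a := 4 * κ) (b := bx) (by positivity) hbx hℓ hr heA heD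
    heR hRg hM hpos hH hHst hdV0 hdV hρ hsmall hA hJ ?_ ?_ hc3 hc3' hc3'' ?_ hAn
  · -- (c1) at the solution scale, from (ℓ1), (ℓ2) and the coordinates
    intro i ε Vk B hε hεD hreg hBg hBK
    rw [hdom i]
    have hsupp : IsSupportedOn (bondsOf (pts (I i).k (I i).Λ)) (ιA i B) :=
      IsSupportedOn.mono (fun _ hb => hb.1) (hι1 i B hBg)
    refine orbit_expMul_subset ch hsupp (hext0 i Vk) (t := κ * ‖B‖)
      (fun b => (hexp _).trans (mul_le_mul_of_nonneg_left (hι3 i B b) hκ)) fun p hp => ?_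
    have h1 := hextZ i ε Vk hε hεD hreg p hp
    have h2 := he1 i ε hε hεD
    have h3 : 4 * (κ * ‖B‖) ≤ 4 * κ * (2 * (I i).M ^ 5 * hst * cJ / γ) * ε := by
      have := mul_le_mul_of_nonneg_left hBK hκ
      nlinarith
    nlinarith
  · -- (c2) from the representative, the chart letters and the coordinates
    intro i ε Vk V hε hεD hreg hV
    obtain ⟨u, hu, hagree, hsmall'⟩ := hrep i ε Vk V hε hεD hreg hV
    obtain ⟨A, hAsupp, hAval, -, hAeq⟩ := exists_vecField_expMul_eq ch (hδc i) (hlog i) hagree hsmall'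
    have hAb : ∀ b, ‖A b‖ ≤ Cℓ * δc i := by
      intro b
      rcases hAval b with h | h
      · rw [h, norm_zero]; exact mul_nonneg hCℓ (hδc i).le
      · by_cases hcase : b ∈ T i ∨ b ∉ bondsOf (pts (I i).k (I i).Λ)
        · rw [h, hagree b hcase, mul_inv_cancel, ch.ilog_one, norm_zero]
          exact mul_nonneg hCℓ (hδc i).le
        · have hd : dist1 (gaugeAct u V b * (ext i Vk b)⁻¹) < δc i := by
            push Not at hcase
            exact hsmall' b hcase.2 hcase.1
          rw [h]
          exact (hlip i _ hd).trans (mul_le_mul_of_nonneg_left hd.le hCℓ)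
    obtain ⟨B, hBg, hBι, hBn⟩ := hι2 i A (Cℓ * δc i) hAsupp hAb
    refine ⟨B, hBg, hBn.trans (hN i), ?_⟩
    show V ∈ orbit (pts (I i).k (I i).Λ) (expMul ch (ιA i B) (ext i Vk))
    rw [hBι, hAeq]
    exact mem_orbit_comm.1 (gaugeAct_mem_orbit hu V)
  · -- (c4) from (ℓ1), (ℓ2)
    intro i ε Vk B hε hreg hBg hBr p hp
    have h := B15Prop1ChartDeviation.dist1_plaqHol_expMul_le_of_forall ch (ιA i B) (ext i Vk) p
      (fun b => (hexp _).trans (mul_le_mul_of_nonneg_left (hι3 i B b) hκ))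
    have h' := hextΛ i ε Vk hε hreg p hp
    show dist1 (plaqHol (expMul ch (ιA i B) (ext i Vk)) p) ≤ 4 * κ * ‖B‖ + bx * (I i).M ^ 2 * ε
    linarith

end Letters

end Literature.MathematicalPhysics.QuantumFieldTheory.Balaban1983to89.B15Prop1LocalLettersModel

end
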